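import Mathlib.LinearAlgebra.Eigenspace.Basic
import Mathlib.LinearAlgebra.Matrix.ToLinearEquiv
import Literature.Computability.AlgebraicComplexity.LandsbergRessayreNormalForm
import Literature.Computability.AlgebraicComplexity.LRCanonicalSubspaces
import HarnessLib

/-!
# Landsberg–Ressayre, Thm. 2.8 — from an equivariant representation to the pencil datum

Topic `Literature/Computability/AlgebraicComplexity`.  Bridge between the tree's
`IsEquivariantDetRepr (leftMonomialSubst ℂ m) f A` (`LandsbergRessayre.lean`, `EquivariantDC.lean`)
and the abstract pencil of `LRCanonicalSubspaces.lean` (LR17 §1, §3: `Ã = Λ + A`,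
`𝔾_A → GL(V)`):

* `coeffMat A v` — the coefficient matrix `A_v` of the variable `x_v` in a matrix of polynomials,
  and the affine decomposition `p = p(0) + Σ_v (∂p/∂x_v)(0) x_v` of a polynomial of total degree
  `≤ 1` (`eq_affine_of_totalDegree_le_one`), hence `Ã(v) = Λ + Σ_v v_v A_v` (`map_eval_eq`);
* coefficient extraction from the two sides of an exact lift `Ã(γ·x) = g Ã(x) h⁻¹`:
  `coeffMat (g Ã h') v = g A_v h'` and `coeffMat (Ã(γ·x)) v = Σ_i γ_{v i} A_i`;
* the monomial symmetries as elements of `GL(m²)`: Mathlib's `GeneralLinearGroup.kronecker g 1`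
  (`= g ⊗ 1`) for `g = diagUnit d` (cf. Mathlib `Matrix.diagonal`, the tree's `diagonalGL` in another
  topic) and `g = permUnit σ` (`= (Matrix.permMatrixHom).toHomUnits σ⁻¹`), and their membership in
  `leftMonomialSubst` (LR17 §2.1);
* `liftOfMatrices`: matrices `g, h ∈ GL_n` with `g Λ = Λ h`, `g A_{kj} = c_k A_{σk,j} h` give an
  exact `Lift` of the pencil `(toLin' Λ, toLin' A_{kj})`;
* `exists_eigenvalue_of_finrank_ker_eq_one`: on the `C`-stable line `ker Λ` of a regular
  representation, `C` acts by a scalar `γ₀ ≠ 0` (the input `ker_le` of a torus datum).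

## References

* J. M. Landsberg, N. Ressayre, *Permanent v. determinant: an exponential lower bound assuming
  symmetry and a potential path towards Valiant's conjecture*, Differential Geom. Appl. 55 (2017)
  146–166, arXiv:1508.05788: §1 (`Ã = Λ + A`, Defs. 1.2, 1.3), §2.1 (`N(T^{GL(E)})`).
-/

noncomputable section

namespace Literature.Computability.AlgebraicComplexity

namespace LRPencil

open Matrix MvPolynomial Finset
open scoped Kronecker

/-! ### Affine polynomials and coefficient matrices -/

section Affine

variable {R : Type*} [CommRing R] {σ : Type*}

/-- An exponent vector of degree `≤ 1` is `0` or a unit vector. [folklore] -/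
theorem exists_single_of_sum_le_one {d : σ →₀ ℕ} (h0 : d ≠ 0) (h : (d.sum fun _ e => e) ≤ 1) :
    ∃ v, d = Finsupp.single v 1 := by
  rcases Nat.le_one_iff_eq_zero_or_eq_one.1 h with h | h
  · exact absurd ((Finsupp.degree_eq_zero_iff d).1 h) h0
  · exact (Finsupp.sum_eq_one_iff d).1 h

variable {ι : Type*}

/-- The coefficient matrix `A_v` of the variable `x_v` (LR17 §1: the linear part `A` of `Ã`,
one matrix per coordinate). [cite: LandsbergRessayre2017, §1] -/
def coeffMat (A : Matrix ι ι (MvPolynomial σ R)) (v : σ) : Matrix ι ι R :=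
  A.map (coeff (Finsupp.single v 1))

/-- Entries of `coeffMat`. [cite: LandsbergRessayre2017, §1] -/
@[simp] theorem coeffMat_apply (A : Matrix ι ι (MvPolynomial σ R)) (v : σ) (r c : ι) :
    coeffMat A v r c = coeff (Finsupp.single v 1) (A r c) := rfl

/-- `coeff_v (p · C a) = coeff_v p · a`. [folklore] -/
theorem coeff_mul_C' (d : σ →₀ ℕ) (p : MvPolynomial σ R) (a : R) : coeff d (p * C a) = coeff d p * a := by
  rw [mul_comm, coeff_C_mul, mul_comm]

/-- Coefficient extraction on the right-hand side of a lift: `coeffMat (g Ã h') v = g A_v h'`.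
[cite: LandsbergRessayre2017, §1] -/
theorem coeffMat_C_mul_mul_C [Fintype ι] (g : Matrix ι ι R) (A : Matrix ι ι (MvPolynomial σ R))
    (h : Matrix ι ι R) (v : σ) :
    coeffMat (g.map C * A * h.map C) v = g * coeffMat A v * h := by
  ext r c
  simp only [coeffMat_apply, Matrix.mul_apply, Matrix.map_apply, coeff_sum, coeff_mul_C',
    coeff_C_mul]

variable [Fintype σ]

/-- **Affine decomposition**: a polynomial of total degree `≤ 1` is
`p = p(0) + Σ_v c_v x_v` with `c_v` the coefficient of `x_v`. [folklore] -/
theorem eq_affine_of_totalDegree_le_one (p : MvPolynomial σ R) (hp : p.totalDegree ≤ 1) :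
    p = C (coeff 0 p) + ∑ v, C (coeff (Finsupp.single v 1) p) * X v := by
  classical
  apply MvPolynomial.ext
  intro d
  simp only [coeff_add, coeff_C, coeff_sum, coeff_C_mul, coeff_X]
  by_cases h0 : d = 0
  · subst h0
    rw [if_pos rfl]
    have : ∀ v : σ, (Finsupp.single v 1 = (0 : σ →₀ ℕ)) = False := fun v =>
      propext ⟨fun h => one_ne_zero (Finsupp.single_eq_zero.1 h), False.elim⟩
    simp [this]
  · rw [if_neg (Ne.symm h0), zero_add]
    by_cases h1 : ∃ v, d = Finsupp.single v 1
    · obtain ⟨v, rfl⟩ := h1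
      rw [sum_eq_single v]
      · rw [if_pos rfl, mul_one]
      · intro w _ hw
        rw [if_neg (fun h => hw (Finsupp.single_left_injective one_ne_zero h)), mul_zero]
      · simp
    · have hd : coeff d p = 0 := by
        rw [← notMem_support_iff]
        intro hmem
        exact h1 (exists_single_of_sum_le_one h0 ((le_totalDegree hmem).trans hp))
      rw [hd]
      symm
      refine sum_eq_zero fun v _ => ?_
      rw [if_neg (fun h => h1 ⟨v, h.symm⟩), mul_zero]

/-- `Ã(v) = Λ + Σ_w v_w A_w` for a matrix of affine polynomials (LR17 §1). [cite: LandsbergRessayre2017, §1] -/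
theorem map_eval_eq (A : Matrix ι ι (MvPolynomial σ R)) (hA : ∀ r c, (A r c).totalDegree ≤ 1)
    (v : σ → R) : A.map (MvPolynomial.eval v) = constPart A + ∑ w, v w • coeffMat A w := by
  ext r c
  have h := eq_affine_of_totalDegree_le_one (A r c) (hA r c)
  rw [Matrix.map_apply, Matrix.add_apply, Matrix.sum_apply, constPart_apply, constantCoeff_eq]
  conv_lhs => rw [h]
  simp only [map_add, map_sum, map_mul, eval_C, eval_X, Matrix.smul_apply, coeffMat_apply,
    smul_eq_mul]
  congr 1
  exact sum_congr rfl fun w _ => mul_comm _ _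

end Affine

section Subst

variable {k : Type*} [Field k] {σ : Type*} [Fintype σ] [DecidableEq σ] {ι : Type*}

/-- Coefficient extraction on the left-hand side of a lift: for affine `Ã`,
`coeffMat (Ã(γ·x)) v = Σ_i γ_{v i} A_i`. [cite: LandsbergRessayre2017, §1] -/
theorem coeffMat_linSubstEntries (γ : GL σ k) (A : Matrix ι ι (MvPolynomial σ k))
    (hA : ∀ r c, (A r c).totalDegree ≤ 1) (v : σ) :
    coeffMat (Matrix.linSubstEntries γ A) v = ∑ i, (γ : Matrix σ σ k) v i • coeffMat A i := by
  ext r c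
  rw [coeffMat_apply, Matrix.sum_apply]
  simp only [Matrix.linSubstEntries, Matrix.map_apply, Matrix.smul_apply, coeffMat_apply,
    smul_eq_mul]
  conv_lhs => rw [eq_affine_of_totalDegree_le_one (A r c) (hA r c)]
  simp only [map_add, map_sum, map_mul, linSubst_C, linSubst_X, coeff_add, coeff_C, coeff_sum,
    coeff_C_mul, mul_sum, smul_eq_C_mul, coeff_X]
  rw [if_neg (fun h => one_ne_zero (Finsupp.single_eq_zero.1 h.symm)), zero_add]
  refine sum_congr rfl fun i _ => ?_
  rw [sum_eq_single v]
  · rw [if_pos rfl, mul_one, mul_comm]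
  · intro l _ hl
    rw [if_neg (fun h => hl (Finsupp.single_left_injective one_ne_zero h)), mul_zero, mul_zero]
  · simp

end Subst

/-! ### The monomial symmetries as elements of `GL(m²)` -/

section Units

variable (k : Type*) [Field k] {m : ℕ}

/-- The matrix of `g ⊗ 1 ∈ GL(m²)` (Mathlib's `Matrix.GeneralLinearGroup.kronecker g 1`, the left
action `x ↦ g x` on `M_m`, LR17 §2.1). [folklore] -/
theorem coe_kronecker_one (g : GL (Fin m) k) :
    ((Matrix.GeneralLinearGroup.kronecker g (1 : GL (Fin m) k) : GL (Fin m × Fin m) k) :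
        Matrix (Fin m × Fin m) (Fin m × Fin m) k) = (g : Matrix (Fin m) (Fin m) k) ⊗ₖ 1 :=
  rfl

/-- `g ⊗ 1` is a left monomial symmetry when `g` is monomial. [cite: LandsbergRessayre2017, §2.1] -/
theorem kronecker_one_mem {g : GL (Fin m) k} (hg : g ∈ monomialSubgroup k m) :
    Matrix.GeneralLinearGroup.kronecker g (1 : GL (Fin m) k) ∈ leftMonomialSubst k m :=
  Subgroup.subset_closure ⟨g, hg, rfl⟩

/-- An invertible diagonal matrix as an element of `GL_m` (the unit of `Matrix.diagonal d`). [folklore] -/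
def diagUnit (d : Fin m → k) (hd : ∀ i, d i ≠ 0) : GL (Fin m) k where
  val := Matrix.diagonal d
  inv := Matrix.diagonal fun i => (d i)⁻¹
  val_inv := by
    rw [Matrix.diagonal_mul_diagonal, ← Matrix.diagonal_one]
    congr 1; funext i; exact mul_inv_cancel₀ (hd i)
  inv_val := by
    rw [Matrix.diagonal_mul_diagonal, ← Matrix.diagonal_one]
    congr 1; funext i; exact inv_mul_cancel₀ (hd i)

/-- The matrix of `diagUnit`. [folklore] -/
@[simp] theorem coe_diagUnit (d : Fin m → k) (hd : ∀ i, d i ≠ 0) :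
    (diagUnit k d hd : Matrix (Fin m) (Fin m) k) = Matrix.diagonal d := rfl

/-- Diagonal matrices are monomial (the torus `T^{GL(E)}`, LR17 §2.1). [cite: LandsbergRessayre2017, §2.1] -/
theorem diagUnit_mem (d : Fin m → k) (hd : ∀ i, d i ≠ 0) : diagUnit k d hd ∈ monomialSubgroup k m :=
  Subgroup.subset_closure (Or.inr ⟨d, rfl⟩)

/-- A permutation matrix as an element of `GL_m`; equals `(Matrix.permMatrixHom (R := k)).toHomUnits σ⁻¹`
(Mathlib's `permMatrixHom σ = σ⁻¹.permMatrix`), written out to match the generators `π.permMatrix` of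
`monomialSubgroup`. [folklore] -/
def permUnit (σ : Equiv.Perm (Fin m)) : GL (Fin m) k where
  val := σ.permMatrix k
  inv := σ⁻¹.permMatrix k
  val_inv := by rw [← Matrix.permMatrix_mul, inv_mul_cancel, Matrix.permMatrix_one]
  inv_val := by rw [← Matrix.permMatrix_mul, mul_inv_cancel, Matrix.permMatrix_one]

/-- The matrix of `permUnit σ` is `σ.permMatrix`. [folklore] -/
@[simp] theorem coe_permUnit (σ : Equiv.Perm (Fin m)) :
    (permUnit k σ : Matrix (Fin m) (Fin m) k) = σ.permMatrix k := rfl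

/-- Permutation matrices are monomial (`𝔖_m ⊆ N(T^{GL(E)})`, LR17 §2.1). [cite: LandsbergRessayre2017, §2.1] -/
theorem permUnit_mem (σ : Equiv.Perm (Fin m)) : permUnit k σ ∈ monomialSubgroup k m :=
  Subgroup.subset_closure (Or.inl ⟨σ, rfl⟩)

/-- The substitution of `diag(d) ⊗ 1` on coefficient matrices: row `k₀` is scaled by `d k₀`.
[cite: LandsbergRessayre2017, §2.1] -/
theorem sum_kron_diagonal_smul {M : Type*} [AddCommMonoid M] [Module k M] (d : Fin m → k)
    (B : Fin m × Fin m → M) (v : Fin m × Fin m) :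
    ∑ i, ((Matrix.diagonal d) ⊗ₖ (1 : Matrix (Fin m) (Fin m) k)) v i • B i = d v.1 • B v := by
  rw [Fintype.sum_prod_type, sum_eq_single v.1]
  · rw [sum_eq_single v.2]
    · simp
    · intro j _ hj
      simp [Ne.symm hj]
    · simp
  · intro i _ hi
    refine sum_eq_zero fun j _ => ?_
    simp [Ne.symm hi]
  · simp

/-- The substitution of `P_σ ⊗ 1` on coefficient matrices: row `k₀` goes to row `σ k₀`.
[cite: LandsbergRessayre2017, §2.1] -/
theorem sum_kron_permMatrix_smul {M : Type*} [AddCommMonoid M] [Module k M] (σ : Equiv.Perm (Fin m))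
    (B : Fin m × Fin m → M) (v : Fin m × Fin m) :
    ∑ i, ((σ.permMatrix k) ⊗ₖ (1 : Matrix (Fin m) (Fin m) k)) v i • B i = B (σ v.1, v.2) := by
  rw [Fintype.sum_prod_type, sum_eq_single (σ v.1)]
  · rw [sum_eq_single v.2]
    · simp [Equiv.Perm.permMatrix, PEquiv.toMatrix_apply]
    · intro j _ hj
      simp [Ne.symm hj]
    · simp
  · intro i _ hi
    refine sum_eq_zero fun j _ => ?_
    simp [Equiv.Perm.permMatrix, PEquiv.toMatrix_apply, Ne.symm hi]
  · simp

end Units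

/-! ### From matrices to an exact lift of the pencil -/

section MatrixLift

variable {m n : ℕ}

/-- Matrices `g, h ∈ GL_n` with `g Λ = Λ h` and `g A_{kj} = c_k · A_{σ k, j} h` give an exact
`Lift` of the pencil `(toLin' Λ, toLin' A_{kj})` (LR17 Def. 1.3 in coordinates). [cite: LandsbergRessayre2017, Def. 1.3] -/
def liftOfMatrices (Λm : Matrix (Fin n) (Fin n) ℂ) (Am : Fin m → Fin m → Matrix (Fin n) (Fin n) ℂ)
    (σ : Equiv.Perm (Fin m)) (c : Fin m → ℂ) (hc : ∀ k, c k ≠ 0) (g h : GL (Fin n) ℂ)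
    (hΛ : (g : Matrix (Fin n) (Fin n) ℂ) * Λm = Λm * (h : Matrix (Fin n) (Fin n) ℂ))
    (hA : ∀ k j, (g : Matrix (Fin n) (Fin n) ℂ) * Am k j = c k • (Am (σ k) j * (h : Matrix (Fin n) (Fin n) ℂ))) :
    Lift (Matrix.toLin' Λm) (fun k j => Matrix.toLin' (Am k j)) σ c where
  B := Matrix.toLinearEquiv' (g : Matrix (Fin n) (Fin n) ℂ) (Units.invertible g)
  C := Matrix.toLinearEquiv' (h : Matrix (Fin n) (Fin n) ℂ) (Units.invertible h)
  c_ne := hc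
  comm_Λ v := by
    show Matrix.toLin' (g : Matrix (Fin n) (Fin n) ℂ) (Matrix.toLin' Λm v) =
      Matrix.toLin' Λm (Matrix.toLin' (h : Matrix (Fin n) (Fin n) ℂ) v)
    rw [← Matrix.toLin'_mul_apply, hΛ, Matrix.toLin'_mul_apply]
  comm_A k j v := by
    show Matrix.toLin' (g : Matrix (Fin n) (Fin n) ℂ) (Matrix.toLin' (Am k j) v) =
      c k • Matrix.toLin' (Am (σ k) j) (Matrix.toLin' (h : Matrix (Fin n) (Fin n) ℂ) v)
    rw [← Matrix.toLin'_mul_apply, hA, map_smul, LinearMap.smul_apply, Matrix.toLin'_mul_apply]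

end MatrixLift

/-! ### The eigenvalue on the kernel line -/

section KernelLine

variable {V : Type*} [AddCommGroup V] [Module ℂ V]

/-- On a `C`-stable LINE `ker Λ`, `C` acts by a scalar `γ₀ ≠ 0`; hence `ker Λ ⊆ F γ₀`
(LR17 §6: the weight of `ℓ_1`). [cite: LandsbergRessayre2017, §6] -/
theorem exists_eigenvalue_of_finrank_ker_eq_one (Λ : Module.End ℂ V) (C : V ≃ₗ[ℂ] V)
    (hC : (LinearMap.ker Λ).map (C : V →ₗ[ℂ] V) = LinearMap.ker Λ)
    (hK : Module.finrank ℂ (LinearMap.ker Λ) = 1) :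
    ∃ γ₀ : ℂ, γ₀ ≠ 0 ∧ LinearMap.ker Λ ≤ Module.End.maxGenEigenspace (C : V →ₗ[ℂ] V) γ₀ := by
  obtain ⟨v, hv0, hv⟩ := finrank_eq_one_iff'.1 hK
  have hCv : C v.1 ∈ LinearMap.ker Λ := by
    have h := Submodule.mem_map_of_mem (f := (C : V →ₗ[ℂ] V)) v.2
    rwa [hC] at h
  obtain ⟨γ₀, hγ₀⟩ := hv ⟨C v.1, hCv⟩
  have hγ₀' : C v.1 = γ₀ • v.1 := by
    have := congrArg Subtype.val hγ₀
    simpa using this.symm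
  refine ⟨γ₀, fun h0 => hv0 ?_, fun w hw => ?_⟩
  · rw [h0, zero_smul] at hγ₀'
    exact Subtype.ext (C.injective (by rw [hγ₀']; simp))
  · obtain ⟨c, hc⟩ := hv ⟨w, hw⟩
    have hw' : w = c • v.1 := by
      have := congrArg Subtype.val hc; simpa using this.symm
    apply Module.End.eigenspace_le_maxGenEigenspace
    rw [Module.End.mem_eigenspace_iff, LinearEquiv.coe_coe, hw', map_smul, hγ₀', smul_comm]

end KernelLine

end LRPencil

end Literature.Computability.AlgebraicComplexity
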